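import Summits.CriticalPhenomena.PercolationContinuityZ3.Theorems.Transplant.BoxProdZ2ZdInstance
import Summits.CriticalPhenomena.PercolationContinuityZ3.Theorems.Transplant.StatementLattices
import Summits.CriticalPhenomena.PercolationContinuityZ3.Theorems.Transplant.ZdTimesFiniteStrictSlab
import Mathlib.Combinatorics.SimpleGraph.Prod
import HarnessLib

/-!
# Rung R1b is a corollary of the product flagship: `BSConj4_boxProdZ2 → ZdTimesFiniteOwnCriticalContinuity d` for every `d ≥ 3`

builds on p205010 (kernel theorem, internal audit signed; external expert review pending).
Status sentence (coordinator 2026-08-20T04:30Z): "θ(p_c) = 0 on ℤ^d, all d ≥ 2 — kernel-verified (Lean 4/Mathlib,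
standard axioms); internal adversarial audit SIGNED 2026-08-20 04:29Z; external expert review pending."

Lane `prim-bschramm-*`, seat `prim-bschramm-stmt`.  PROOF-ONLY reduction between two of the lane's `@[conjecture]` targets
(`Transplant/StatementBoxProdZ2.lean`, `Transplant/StatementLattices.lean`): `ℤ^{a+2} × F ≅ (ℤ^a × F) × ℤ²`, and for `a ≥ 1` the factor
`X = ℤ^a □ F` (`F` finite connected) is infinite, connected, locally finite and quasi-transitive (p2's `zdTimesFinite_connected`,
`zdTimesFinite_isQuasiTransitive`), so the product target `BSConj4_boxProdZ2` yields the `ℤ^d × F` target at every `d = a + 2 ≥ 3` — LADDER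
coherence: rung R1b (`ℤ^d × F` at its own `p_c`) ⊂ rung R2c / Φ-2 (`X □ ℤ²`).  (The box product is spelled `.boxProd` in this file: the `□`
notation is shadowed by a category-theory notation in the import closure of `BoxProdZ2ZdInstance`.)

* `fin_append_zero` — `Fin.append 0 0 = 0`;
* `zdTimesFiniteProdIso a F : ((zdGraph a □ F) □ zdGraph 2) ≃g (zdGraph (a+2) □ F)` (Mathlib `boxProdAssoc`, `boxProdComm`, the lane's
  `boxProdIso` and `zdGraphProdIso`), with `zdTimesFiniteProdIso_root : e ((0, w), 0) = (0, w)`;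
* **`zdTimesFiniteOwnCriticalContinuity_of_bsConj4_boxProdZ2 (d) (hd : 3 ≤ d) : BSConj4_boxProdZ2 → ZdTimesFiniteOwnCriticalContinuity d`**
  (transport by `theta_iso` / `criticalProb_iso`), and `z3TimesFiniteOwnCriticalContinuity_of_bsConj4_boxProdZ2`.
[cite: BenjaminiSchramm1996, Conj. 4] [cite: MartineauPanagiotis2025, Prop. 1.10]
-/

noncomputable section

namespace Summit.CriticalPhenomena.PercolationContinuityZ3.Theorems.Transplant

open MeasureTheory Literature.Probability.Percolation Literature.Probability.LatticeModels
open Literature.Barriers.CriticalPhenomena (IsQuasiTransitive)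

/-- `Fin.append 0 0 = 0`. [folklore] -/
theorem fin_append_zero (m n : ℕ) : Fin.append (0 : Fin m → ℤ) (0 : Fin n → ℤ) = 0 := by
  ext i
  induction i using Fin.addCases with
  | left i => rw [Fin.append_left]; rfl
  | right j => rw [Fin.append_right]; rfl

variable {W : Type} (F : SimpleGraph W)

/-- **`(ℤ^a × F) × ℤ² ≅ ℤ^{a+2} × F`** as graphs: reassociate, commute the last two factors, reassociate, and merge `ℤ^a □ ℤ² ≅ ℤ^{a+2}`
(`zdGraphProdIso`). [folklore] -/
def zdTimesFiniteProdIso (a : ℕ) : (((zdGraph a).boxProd F).boxProd (zdGraph 2)) ≃g ((zdGraph (a + 2)).boxProd F) :=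
  (SimpleGraph.boxProdAssoc (G := zdGraph a) (H := F) (zdGraph 2)).trans
    ((boxProdIso (RelIso.refl (zdGraph a).Adj) (SimpleGraph.boxProdComm (G := F) (H := zdGraph 2))).trans
      ((SimpleGraph.boxProdAssoc (G := zdGraph a) (H := zdGraph 2) F).symm.trans
        (boxProdIso (zdGraphProdIso a 2) (RelIso.refl F.Adj))))

/-- The iso sends the root `((0, w), 0)` to `(0, w)`. [folklore] -/
theorem zdTimesFiniteProdIso_root (a : ℕ) (w : W) :
    zdTimesFiniteProdIso F a (((0 : Site a), w), (0 : Site 2)) = ((0 : Site (a + 2)), w) := by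
  simp [zdTimesFiniteProdIso, boxProdIso_apply, zdGraphProdIso_apply, fin_append_zero]

/-- **R1b ⇐ R2c**: the product target `BSConj4_boxProdZ2` implies the `ℤ^d × F` target for every `d ≥ 3` (`X = ℤ^{d-2} □ F` is infinite,
connected, locally finite, quasi-transitive for `F` finite connected). [cite: BenjaminiSchramm1996, Conj. 4] [cite: MartineauPanagiotis2025, Prop. 1.10] -/
theorem zdTimesFiniteOwnCriticalContinuity_of_bsConj4_boxProdZ2 (d : ℕ) (hd : 3 ≤ d) (h : BSConj4_boxProdZ2) :
    ZdTimesFiniteOwnCriticalContinuity d := by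
  obtain ⟨a, rfl⟩ : ∃ a, d = a + 2 := ⟨d - 2, by omega⟩
  have ha : 1 ≤ a := by omega
  intro W _ F hF w
  classical
  haveI : Nonempty W := ⟨w⟩
  haveI : Nonempty (Fin a) := ⟨⟨0, ha⟩⟩
  haveI : Infinite (Site a) := Pi.infinite_of_right
  haveI : Infinite (Site a × W) := Prod.infinite_of_left
  -- the product target at `X = ℤ^a □ F`, root `((0, w), 0)`
  have hX := h ((zdGraph a).boxProd F) (zdTimesFinite_connected F hF) (zdTimesFinite_isQuasiTransitive F) inferInstance ((0 : Site a), w)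
  -- transport along the isomorphism
  set e := zdTimesFiniteProdIso F a with he
  have hθ : ∀ p, theta ((zdGraph (a + 2)).boxProd F) (e (((0 : Site a), w), (0 : Site 2))) p =
      theta (((zdGraph a).boxProd F).boxProd (zdGraph 2)) (((0 : Site a), w), (0 : Site 2)) p := fun p => theta_iso e _ p
  have hpc : criticalProbIOf (((zdGraph a).boxProd F).boxProd (zdGraph 2)) (((0 : Site a), w), (0 : Site 2)) =
      criticalProbIOf ((zdGraph (a + 2)).boxProd F) (e (((0 : Site a), w), (0 : Site 2))) :=
    Subtype.ext (criticalProb_iso e _).symm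
  rw [← hθ, hpc, he, zdTimesFiniteProdIso_root] at hX
  exact hX

/-- The `d = 3` instance: `BSConj4_boxProdZ2 → Z3TimesFiniteOwnCriticalContinuity` (`X = ℤ □ F`). [cite: MartineauPanagiotis2025, Prop. 1.10] -/
theorem z3TimesFiniteOwnCriticalContinuity_of_bsConj4_boxProdZ2 (h : BSConj4_boxProdZ2) : Z3TimesFiniteOwnCriticalContinuity :=
  zdTimesFiniteOwnCriticalContinuity_of_bsConj4_boxProdZ2 3 le_rfl h

end Summit.CriticalPhenomena.PercolationContinuityZ3.Theorems.Transplant
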